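import Literature.Probability.RandomPlanarGeometry.HexSAWBrickWallStripFugacityWidthOneContactSusceptibility
import HarnessLib

/-!
# The Hessian of the two-wall free energy: second directional derivatives and strict convexity with explicit modulus

Child module of `…ContactSusceptibility` (the density map `g(A,B) = (b(e^A,e^B), b(e^B,e^A))` — the gradient of the free energy
`F(A,B) = log μ₁(e^A, e^B)` — is strictly differentiable with derivative `M⁻¹`, `M = −Hess s` at the typical pair).  Along every line
`t ↦ (A + t v₁, B + t v₂)`:
* §1 ★★★ the FIRST directional derivative of `F` is `⟨g, v⟩ = v₁ b + v₂ b'` at every `t` (the tree's `hasDerivAt_log_stripMuY₂_dir`, moved to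
  an arbitrary base point), and the SECOND directional derivative at `t = 0` is the quadratic form
  `H(v) = (m₂₂ v₁² − 2 m₁₂ v₁ v₂ + m₁₁ v₂²)/D` of `M⁻¹` (`D = m₁₁m₂₂ − m₁₂²`);
* §2 ★★ `H(v) > 0` for `v ≠ 0` (the inverse of a positive definite matrix): the free energy is STRICTLY CONVEX in the log-fugacities with an
  explicit modulus — the dual statement to #723's curvature `Q` of the rate (`H = Q⁻¹` as quadratic forms of inverse matrices).

## Sources
DemboZeitouni2010 §2.2 (Λ smooth and convex, Hessians of Λ and Λ* inverse); JansevanRensburg2000 §3.3 (1st ed., OUP 2000).  Nothing quoted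
AS PRINTED; statements are this lineage's.
-/

noncomputable section

open Filter Topology Finset Literature.Probability.LatticeModels Literature.Probability.Percolation SimpleGraph

namespace Literature.Probability.RandomPlanarGeometry.SAW.HexBW

open WidthOneYZ Real

/-! ## §1 First and second directional derivatives of the free energy -/

/-- ★★ **First directional derivative of the free energy at every parameter**: for all `A, B, v₁, v₂, t`,
`d/dt log μ₁(e^{A+tv₁}, e^{B+tv₂}) = v₁ b(e^{A+tv₁},e^{B+tv₂}) + v₂ b(e^{B+tv₂},e^{A+tv₁})` (the tree's `hasDerivAt_log_stripMuY₂_dir` at the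
base point of parameter `t`). [cite: JansevanRensburg2000, §3.2 Theorem 3.18 (1st ed., p. 51: F′ = density); DemboZeitouni2010, §2.2 (lane statement)] -/
theorem hasDerivAt_log_stripMuY₂_line (A B v₁ v₂ t : ℝ) :
    HasDerivAt (fun s : ℝ => Real.log (stripMuY₂ 1 (Real.exp (A + s * v₁)) (Real.exp (B + s * v₂))))
      (v₁ * contactB (Real.exp (A + t * v₁)) (Real.exp (B + t * v₂)) + v₂ * contactB (Real.exp (B + t * v₂)) (Real.exp (A + t * v₁))) t := by
  have hY := Real.exp_pos (A + t * v₁)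
  have hZ := Real.exp_pos (B + t * v₂)
  have h0 := hasDerivAt_log_stripMuY₂_dir hY hZ v₁ v₂
  -- shift the parameter: `s = t + τ`
  have e : (fun s : ℝ => Real.log (stripMuY₂ 1 (Real.exp (A + s * v₁)) (Real.exp (B + s * v₂)))) =
      (fun τ : ℝ => Real.log (stripMuY₂ 1 (Real.exp (A + t * v₁) * Real.exp (τ * v₁)) (Real.exp (B + t * v₂) * Real.exp (τ * v₂)))) ∘
        (fun s : ℝ => s - t) := by
    funext s
    simp only [Function.comp_apply, ← Real.exp_add]
    congr 2 <;> congr 1 <;> ring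
  rw [e]
  have hsub : HasDerivAt (fun s : ℝ => s - t) 1 t := (hasDerivAt_id t).sub_const t
  have hc := HasDerivAt.comp t (h₂ := fun τ : ℝ => Real.log (stripMuY₂ 1 (Real.exp (A + t * v₁) * Real.exp (τ * v₁))
    (Real.exp (B + t * v₂) * Real.exp (τ * v₂)))) (by rw [sub_self]; exact h0) hsub
  simpa using hc

/-- ★★★ **THE SECOND DIRECTIONAL DERIVATIVE OF THE FREE ENERGY IS THE QUADRATIC FORM OF `M⁻¹`**: for all `A, B, v₁, v₂`, with `(b,b')`
the typical pair at `(e^A,e^B)`, `m₁₁, m₁₂, m₂₂` the entries of `M = −Hess s` there and `D = m₁₁m₂₂ − m₁₂²`: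
`d/dt [v₁ b + v₂ b'](A+tv₁, B+tv₂) |_{t=0} = (m₂₂ v₁² − 2 m₁₂ v₁ v₂ + m₁₁ v₂²)/D`.
[cite: DemboZeitouni2010, §2.2 (Hessian of Λ = inverse Hessian of Λ*; lane statement); JansevanRensburg2000, §3.3 (1st ed.)] -/
theorem hasDerivAt_dirDeriv_log_stripMuY₂ (A B v₁ v₂ : ℝ) :
    let b := contactB (Real.exp A) (Real.exp B)
    let b' := contactB (Real.exp B) (Real.exp A)
    let m₁₁ := 4 / (1 - 2 * b - 2 * b') + 8 / (4 * b + 2 * b' - 1) + 2 / (2 * b + 4 * b' - 1) - 1 / b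
    let m₁₂ := 4 / (1 - 2 * b - 2 * b') + 4 / (4 * b + 2 * b' - 1) + 4 / (2 * b + 4 * b' - 1)
    let m₂₂ := 4 / (1 - 2 * b - 2 * b') + 2 / (4 * b + 2 * b' - 1) + 8 / (2 * b + 4 * b' - 1) - 1 / b'
    HasDerivAt (fun t : ℝ => v₁ * contactB (Real.exp (A + t * v₁)) (Real.exp (B + t * v₂)) +
        v₂ * contactB (Real.exp (B + t * v₂)) (Real.exp (A + t * v₁)))
      ((m₂₂ * v₁ ^ 2 - 2 * m₁₂ * v₁ * v₂ + m₁₁ * v₂ ^ 2) / (m₁₁ * m₂₂ - m₁₂ ^ 2)) 0 := by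
  intro b b' m₁₁ m₁₂ m₂₂
  obtain ⟨E, hE, hg⟩ := hasStrictFDerivAt_densityMap A B
  obtain ⟨hD, -, -, -, -, -, -⟩ := hasDerivAt_contactB_log A B
  set D := m₁₁ * m₂₂ - m₁₂ ^ 2 with hDdef
  have hD0 : D ≠ 0 := ne_of_gt hD
  -- `E⁻¹ v = (1/D)(m₂₂ v₁ − m₁₂ v₂, −m₁₂ v₁ + m₁₁ v₂)`
  have hinv : E.symm (v₁, v₂) = ((m₂₂ * v₁ - m₁₂ * v₂) / D, (-m₁₂ * v₁ + m₁₁ * v₂) / D) := by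
    have h := hE ((m₂₂ * v₁ - m₁₂ * v₂) / D, (-m₁₂ * v₁ + m₁₁ * v₂) / D)
    have e : E ((m₂₂ * v₁ - m₁₂ * v₂) / D, (-m₁₂ * v₁ + m₁₁ * v₂) / D) = (v₁, v₂) := by
      rw [h]
      refine Prod.ext ?_ ?_
      · show m₁₁ * ((m₂₂ * v₁ - m₁₂ * v₂) / D) + m₁₂ * ((-m₁₂ * v₁ + m₁₁ * v₂) / D) = v₁
        field_simp; rw [hDdef]; ring
      · show m₁₂ * ((m₂₂ * v₁ - m₁₂ * v₂) / D) + m₂₂ * ((-m₁₂ * v₁ + m₁₁ * v₂) / D) = v₂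
        field_simp; rw [hDdef]; ring
    rw [← e, ContinuousLinearEquiv.symm_apply_apply]
  -- the line and the chain rule
  have hline : HasDerivAt (fun t : ℝ => ((A + t * v₁, B + t * v₂) : ℝ × ℝ)) ((v₁, v₂) : ℝ × ℝ) 0 := by
    have h1 : HasDerivAt (fun t : ℝ => A + t * v₁) v₁ 0 := by simpa using ((hasDerivAt_id (0 : ℝ)).mul_const v₁).const_add A
    have h2 : HasDerivAt (fun t : ℝ => B + t * v₂) v₂ 0 := by simpa using ((hasDerivAt_id (0 : ℝ)).mul_const v₂).const_add B
    exact h1.prodMk h2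
  have hg0 : HasFDerivAt (fun q : ℝ × ℝ => ((contactB (Real.exp q.1) (Real.exp q.2), contactB (Real.exp q.2) (Real.exp q.1)) : ℝ × ℝ))
      (E.symm : (ℝ × ℝ) →L[ℝ] (ℝ × ℝ)) ((A + 0 * v₁, B + 0 * v₂) : ℝ × ℝ) := by
    simp only [zero_mul, add_zero]; exact hg.hasFDerivAt
  have hcomp := hg0.comp_hasDerivAt (0 : ℝ) hline
  rw [ContinuousLinearEquiv.coe_coe, hinv] at hcomp
  -- pair with the fixed covector `(v₁, v₂)`
  have hpair : HasDerivAt (fun t : ℝ => v₁ * contactB (Real.exp (A + t * v₁)) (Real.exp (B + t * v₂)) +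
      v₂ * contactB (Real.exp (B + t * v₂)) (Real.exp (A + t * v₁)))
      (v₁ * ((m₂₂ * v₁ - m₁₂ * v₂) / D) + v₂ * ((-m₁₂ * v₁ + m₁₁ * v₂) / D)) 0 := by
    have d1 := ((hasFDerivAt_fst (𝕜 := ℝ) (E := ℝ) (F := ℝ)).comp_hasDerivAt 0 hcomp).const_mul v₁
    have d2 := ((hasFDerivAt_snd (𝕜 := ℝ) (E := ℝ) (F := ℝ)).comp_hasDerivAt 0 hcomp).const_mul v₂
    have := d1.add d2
    simp only [Function.comp_def] at this
    exact this
  refine hpair.congr_deriv ?_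
  field_simp
  ring

/-! ## §2 The quadratic form of `M⁻¹` is positive definite -/

/-- Completing the square: `m₁₁ (m₂₂ v₁² − 2 m₁₂ v₁ v₂ + m₁₁ v₂²) = (m₁₁ v₂ − m₁₂ v₁)² + D v₁²`, so the form of the
inverse matrix is positive at every `(v₁, v₂) ≠ 0` once `m₁₁ > 0` and `D = m₁₁ m₂₂ − m₁₂² > 0`. [folklore] -/
private theorem inverseForm_pos {m₁₁ m₁₂ m₂₂ v₁ v₂ : ℝ} (hm11 : 0 < m₁₁) (hD : 0 < m₁₁ * m₂₂ - m₁₂ ^ 2)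
    (hv : (v₁, v₂) ≠ (0, 0)) :
    0 < (m₂₂ * v₁ ^ 2 - 2 * m₁₂ * v₁ * v₂ + m₁₁ * v₂ ^ 2) / (m₁₁ * m₂₂ - m₁₂ ^ 2) := by
  have key : m₁₁ * (m₂₂ * v₁ ^ 2 - 2 * m₁₂ * v₁ * v₂ + m₁₁ * v₂ ^ 2) =
      (m₁₁ * v₂ - m₁₂ * v₁) ^ 2 + (m₁₁ * m₂₂ - m₁₂ ^ 2) * v₁ ^ 2 := by ring
  have hnum : 0 < m₂₂ * v₁ ^ 2 - 2 * m₁₂ * v₁ * v₂ + m₁₁ * v₂ ^ 2 := by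
    by_cases hv1 : v₁ = 0
    · have hv2 : v₂ ≠ 0 := by intro h; exact hv (by rw [hv1, h])
      have : 0 < (m₁₁ * v₂ - m₁₂ * v₁) ^ 2 + (m₁₁ * m₂₂ - m₁₂ ^ 2) * v₁ ^ 2 := by
        rw [hv1]; simp only [mul_zero, sub_zero]; positivity
      nlinarith [key]
    · have : 0 < (m₁₁ * v₂ - m₁₂ * v₁) ^ 2 + (m₁₁ * m₂₂ - m₁₂ ^ 2) * v₁ ^ 2 := by
        have := mul_pos hD (pow_pos (abs_pos.2 hv1) 2)
        rw [sq_abs] at this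
        nlinarith [sq_nonneg (m₁₁ * v₂ - m₁₂ * v₁)]
      nlinarith [key]
  exact div_pos hnum hD

/-- ★★ **STRICT CONVEXITY OF THE FREE ENERGY WITH EXPLICIT MODULUS**: the second directional derivative
`(m₂₂ v₁² − 2 m₁₂ v₁ v₂ + m₁₁ v₂²)/D` is POSITIVE for every `(v₁,v₂) ≠ 0` (inverse of a positive definite matrix: complete the square with
`m₁₁ > 0`, `D > 0`). [cite: DemboZeitouni2010, §2.2 (Λ strictly convex; lane statement)] -/
theorem freeEnergyHessian_pos (A B : ℝ) {v₁ v₂ : ℝ} (hv : (v₁, v₂) ≠ (0, 0)) :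
    let b := contactB (Real.exp A) (Real.exp B)
    let b' := contactB (Real.exp B) (Real.exp A)
    let m₁₁ := 4 / (1 - 2 * b - 2 * b') + 8 / (4 * b + 2 * b' - 1) + 2 / (2 * b + 4 * b' - 1) - 1 / b
    let m₁₂ := 4 / (1 - 2 * b - 2 * b') + 4 / (4 * b + 2 * b' - 1) + 4 / (2 * b + 4 * b' - 1)
    let m₂₂ := 4 / (1 - 2 * b - 2 * b') + 2 / (4 * b + 2 * b' - 1) + 8 / (2 * b + 4 * b' - 1) - 1 / b'
    0 < (m₂₂ * v₁ ^ 2 - 2 * m₁₂ * v₁ * v₂ + m₁₁ * v₂ ^ 2) / (m₁₁ * m₂₂ - m₁₂ ^ 2) := by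
  intro b b' m₁₁ m₁₂ m₂₂
  obtain ⟨t1, t2, t3⟩ := contactB_mem_triangle (Real.exp_pos A) (Real.exp_pos B)
  obtain ⟨hm11, hD⟩ := logTiltDeriv_det_pos t1 t2 t3
  exact inverseForm_pos hm11 hD hv

end Literature.Probability.RandomPlanarGeometry.SAW.HexBW
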